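/-
Copyright (c) 2026 the pub-hodgecm-mathlib formalisation cell (harness21).  Prover seat hodgecm-mathlib-K2Liu-p02 (g8), Track B «K2-LIT» ∕ hLiu418
#184♮, Road I v3, unit U5 «THE CLOSE» STEP C — the #42F′ TOP, EDITION 6 «THE DATUM FACE, hne-FREE» (RULINGS M-158i ∕ M-158k ∕ K2Liu-p10 (g6) merge (R1) 22:24:28Z; SIGS-RoadI-v3 §2 U1, U2, U5).
-/
import Summits.HodgeConjecture.HodgeConjecture.Theorems.K2LiuFirstTermIdentityAssembly          -- ED. 1 (p861854): `‹#41› → ‹FACE-R› → ‹#42F′ :711›`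
import Summits.HodgeConjecture.HodgeConjecture.Theorems.K2LiuRankOneRigidityDegenerate          -- ★ p862421 (K2Liu-p10 g6): `rankOneRigidity_of_eq_smul_split` — U2 WITHOUT `hne`
import Summits.HodgeConjecture.HodgeConjecture.Theorems.K2LiuDoubledLiftSpanReduction           -- ★ `doubledLineThetaLift_smul`
import Summits.HodgeConjecture.HodgeConjecture.Theorems.K2LiuLineThetaSideWitness               -- ★ p858449: a theta datum on any line (used on `⟨1⟩` in the anisotropic branch)
import Summits.HodgeConjecture.HodgeConjecture.Theorems.K2LiuWittLineEmbedding                   -- ★ p861452 (K2Liu-p02 g7): `exists_lineFrame` — the adelic Witt frame of an isotropic `V′`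
import HarnessLib

/-!
# K2_Liu road (hLiu418), Road I v3, U5 «THE CLOSE» STEP C: THE #42F′ TOP — EDITION 6 «THE DATUM FACE, `hne`-FREE» `‹#41› → ‹FACE-A› → ‹FACE-D′› → ‹#42F′ :711›`

Cell `pub/hodgecm-mathlib` (D-0151), Track B, build stream 29.  = ★ ED. 5 `K2LiuFirstTermIdentityAssemblyDatum` (p862477) with ONE conjunct deleted: FACE-D's
trailing `∧ coeff β₀ ∘ₗ codRestrict P T₂ hP₂ ≠ 0` (`hne`).  RULING M-158i (K2Liu-p10 (g6) 22:13Z): a per-domain `hne` is FALSE at the degenerate rigidity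
domain `V = ⊥` (`D_⊥ = 0`, every linear map out of it is `0`), so FACE-D (like FACE-I of ★ ED. 2) is uninhabited there and ED. 5 is true-but-untieable; and
`hne` is not needed — ★ `K2LiuRankOneRigidityDegenerate.rankOneRigidity_of_eq_smul_split` (p862421) concludes `∃ c, ∀ x, T₁ x = c • T₂ x` from the row
`h₁ : coeff β₀ ∘ T₁ = c₁ • (coeff β₀ ∘ T₂)` alone (`c := 0` when `coeff β₀ ∘ T₂ = 0`).  The base is ★ ED. 1 `firstTermIdentityOnGenerators_of_rigidityFace`.
* **FACE-A** («U1-aniso», anisotropic `V′`, unchanged): every admissible residue map `T₁` ((a)(b)(c) of ★ 0c) VANISHES on every rigidity domain `D_V`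
  (Weil's convergent range: `E(s, g_x)` holomorphic at `s₀ = ½` [GanQiuTakeda2014, §3.6 + §7.1 Thm. 18 (anisotropic case); Ichino2007]); the TOP answers FACE-R with `a′ := 1`, the
  datum of ★ `exists_lineThetaSide_witness` on `⟨1⟩`, `Φ′ := 0`.
* **FACE-D′** (isotropic `V′`): for every LINE OF RECORD `a′` (★ `exists_lineFrame`'s frame equation and discriminant clause BY VALUE) the PAYER names a theta
  datum `(hρ, μW, fw)` (`μW` finite, `U(⟨a′⟩)(𝔸)`-invariant) and supplies on every `D_V`, for every admissible `T₁`: `∃ 𝓣 T₂`, `T₂ = B_{fw} ∘ 𝓣`,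
  `∃ P hP₁ hP₂ coeff R S`, `hdet ∧ hT₁ ∧ hT₂ ∧ h2₁ ∧ h2₂ ∧ hfin₁ ∧ hfin₂ ∧ ∃ c₁, coeff β₀ ∘ T₁ = c₁ • (coeff β₀ ∘ T₂)` — NO `hne`, NO surjectivity.
DEGENERATE-INSTANCE LINE (σ23): at `V = ⊥` FACE-D′ is inhabited by `𝓣 := 0, T₂ := 0, P := ⊥, coeff := 0, R := 0, S := 0, c₁ := 0` (all rows `0 = 0` or
vacuous); on the anisotropic branch FACE-A is the only content.  CENTRAL-CHARACTER LINE (σ24 ∕ M-158k): the datum is EXISTENTIAL, so the payer names THE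
WEIGHT OF RECORD `fw₀` himself (P8: `χ₀ ∘ adelicCenter = μ̃(u²)`, `μ̃ = toHeckeCharacter L lam⁻¹`, ★ `K2LiuLineThetaCentralDatum.exists_lineThetaDatum_central`,
K2Liu-p09 (g8)); no `∀ χ`, hence no `hχZ` row.  WHY `h₁` PINS THE WEIGHT (p02 22:23Z ∕ p09 22:16Z): the residue side's `β₀`-functional is semi-invariant for ONE
character (★ `K2LiuResidueMapPartnerSemiInvariance`, ★ `residue_centre_mul`), the theta side's for the weight's (★ `doubledLineThetaLift_pairRep_inr_of_eigen`,
★ `doubledLineThetaLift_mul_centre`); different characters ⇒ never proportional unless zero.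
REMAINING BY VALUE: FACE-A (U1-aniso ∕ ★ U1-glob at a definite place); in FACE-D′ the carrier `𝓣 := 𝓡` ((F3) small mover; `T₂ := Bl ∘ₗ 𝓡` ★ (t)), `P` ∕ `coeff
:= fourierCoeffDelta` (★ (c)) with `hdet` (★ `K2LiuResidueMapHolType` on `P_k`; general `V`: `K2LiuValueClassNoCharacters`, K2Liu-p09), `hP₁ hP₂`, `hT₁ hT₂` (U3),
`h2₁ h2₂` (F-T1-coinv ∕ U4 + ★ U2a), `hfin₁ hfin₂` (★ U2c), `h₁` (★ `K2LiuResidueMapCoinvariance` + ★ U2e + (xii) U2b-local F0P2-p10 + P8 datum ★ (A)).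
No definition, no instance, no notation, no named-fact hypothesis, no `sorry`; axioms ⊆ {propext, Classical.choice, Quot.sound}.  HONEST LABEL: HC_CM is proved only
modulo the 7 printed citations (2 remaining named inputs: hLiu418 = stmt-HodgeConjecture-24832, h413 = stmt-HodgeConjecture-24833) until rung 0 closes; `--supports
stmt-HodgeConjecture-24832 --as helper` helper, closes nothing, moves no counter.
References: [GanQiuTakeda2014] Invent. Math. 198 (2014) §2.6–2.8, §3.6, §7.1 Thm. 18, §7.2 Thm. 20 (i); [Ichino2007] A. Ichino, Math. Z. 255 (2007) 721–729; [KudlaRallis1994] Ann. of Math. 140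
(1994) §1 Thm. 1.1, §3; [HarrisKudlaSweet1996] J. AMS 9 (1996) §1 (1.15)–(1.17); [Scharlau1985HermitianForms] Grundlehren 270 Ch. 7 §9; [Liu2021] Camb. J. Math. 9
(2021) App. B Lem. B.9–B.12, proof of Prop. B.8 pp. 103–106.
-/

set_option autoImplicit false
set_option linter.dupNamespace false

noncomputable section
open scoped Matrix Topology TensorProduct SchwartzMap Classical  -- `Classical`: the `Fintype` of real ∕ complex places inside `mixedSpace (L⁺)` (as in ★ U2f)
open NumberField NumberField.mixedEmbedding IsDedekindDomain MeasureTheory Filter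

namespace Summit.HodgeConjecture.HodgeConjecture.Cruxes.HLiu418.K2LiuFirstTermIdentityAssemblyDatumPrime

open Literature.NumberTheory.Automorphic Literature.NumberTheory.Automorphic.UnitaryGroup Literature.NumberTheory.GaloisRepresentations
open Literature.NumberTheory.GelbartRogawski1991 Literature.NumberTheory.GelbartRogawski1991.GRConstruction
open Literature.NumberTheory.GelbartRogawski1991.UnitaryDualPair
open Literature.NumberTheory.K2Lit.SiegelDoubled Literature.NumberTheory.K2Lit.DoubledLineTheta
open Literature.NumberTheory.Automorphic.IdeleClassGroup
open Literature.NumberTheory.Automorphic.Liu2021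
open Literature.NumberTheory.Automorphic.Liu2021.Def411WeilCarriers
open Literature.NumberTheory.Automorphic.Liu2021.Def411WeilCarriersDoubling
open Literature.NumberTheory.Weil1964
open Literature.RepresentationTheory.Liu2021
open Literature.RepresentationTheory.HarrisKudlaSweet1996 (IsSplittingChar)
open Summit.HodgeConjecture.HodgeConjecture.Cruxes.HLiu418.K2LiuFirstTermResidueFormDefs (resNorm)
open Summit.HodgeConjecture.HodgeConjecture.Cruxes.HLiu418.K2LiuFirstTermIdentityAssembly (firstTermIdentityOnGenerators_of_rigidityFace)
open Summit.HodgeConjecture.HodgeConjecture.Cruxes.HLiu418.K2LiuRankOneRigidityDegenerate (rankOneRigidity_of_eq_smul_split)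
open Summit.HodgeConjecture.HodgeConjecture.Cruxes.HLiu418.K2LiuDoubledLiftSpanReduction (doubledLineThetaLift_smul)
open Summit.HodgeConjecture.HodgeConjecture.Cruxes.HLiu418.K2LiuLineThetaSideWitness (exists_lineThetaSide_witness)
open Summit.HodgeConjecture.HodgeConjecture.Cruxes.HLiu418.K2LiuWittLineEmbedding (exists_lineFrame)

set_option maxHeartbeats 4000000 in -- #41 by value + FACE-A + FACE-D′ (datum + carrier telescope); ED. 3∕4 measured: 2400000 times out at `whnf` on the STATEMENT
/-- **U5 STEP C, EDITION 6 — THE #42F′ TOP WITH THE `hne`-FREE DATUM FACE: `‹#41› → ‹FACE-A› → ‹FACE-D′› → ‹#42F′›`.**  Conclusion =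
`sig_K2LiuFirstTermIdentityOnGenerators` (U6 ED. 12 :711–771) BY VALUE, bytes verbatim; hypotheses = socket #41 (:289) BY VALUE, **FACE-A** (anisotropic `V′`:
every admissible residue map vanishes) and **FACE-D′** (isotropic `V′`: for every Witt-complement line of record, the PAYER's theta datum `(hρ, μW, fw)` and ★ U2's
inputs in the `hne`-free packaging `h₁ : coeff β₀ ∘ T₁ = c₁ • (coeff β₀ ∘ T₂)`).  Proof: ★ ED. 1 after FACE-R — anisotropic: `a′ := 1`, ★ `exists_lineThetaSide_witness`,
`Φ′ := 0`; isotropic: ★ `exists_lineFrame`, ★ `rankOneRigidity_of_eq_smul_split`, `Φ′ := c • 𝓣 x` (★ `doubledLineThetaLift_smul`).  Inhabited at `V = ⊥` by the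
zero witnesses (σ23).  Supersedes ED. 2–5 on the tie path.  Nothing here closes #41 or #42F′.
[cite: GanQiuTakeda2014, §2.6–2.8, §3.6, §7.1 Thm. 18, §7.2 Thm. 20 (i)] [cite: Ichino2007] [cite: KudlaRallis1994, §1 Thm. 1.1, §3]
[cite: HarrisKudlaSweet1996, §1 (1.15)–(1.17)] [cite: Scharlau1985HermitianForms, Ch. 7 §9] [cite: Liu2021, App. B Lem. B.9–B.12, proof of Prop. B.8 pp. 103–106] -/
theorem firstTermIdentityOnGenerators_of_datumInputs'
    (h41 : ∀ (L : Type) [Field L] [NumberField L] [IsCMField L] {n : ℕ} (e : Fin 2 × Fin 1 ≃ Fin n)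
      (dV : Fin 2 → L) (hdV : ∀ i, IsCMField.complexConj L (dV i) = dV i) (hdV0 : ∀ i, dV i ≠ 0)
      (dW : Fin 1 → L) (hdW : ∀ i, IsCMField.complexConj L (dW i) = dW i) (hdW0 : ∀ i, dW i ≠ 0)
      (lam : Literature.NumberTheory.Automorphic.IdeleClassGroup L →ₜ* Circle) (hlam : IsConjugateSymplectic L lam),
      HasWeight L lam 1 →
      ∀ (𝒦 : IwasawaDatum L e dV hdV dW hdW) (_h𝒦 : 𝒦.IsStd) (f : ℂ → HA L e dV hdV dW hdW → ℂ),
        IsStandardSectionFamily 𝒦 (toHeckeCharacter L lam⁻¹) f → (∀ s, Continuous (f s)) →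
      ∃ (P : Finset ℂ) (Es : ℂ → HA L e dV hdV dW hdW → ℂ),
        (∀ h : HA L e dV hdV dW hdW, DifferentiableOn ℂ (fun s => Es s h) {s : ℂ | 0 < s.re}) ∧
        (∀ s : ℂ, 0 < s.re → Continuous (Es s)) ∧
        (∀ s : ℂ, 0 < s.re → ∀ (γ : ratH L e dV hdV dW hdW) (h : HA L e dV hdV dW hdW),
          Es s ((γ : HA L e dV hdV dW hdW) * h) = Es s h) ∧
        (∀ (s : ℂ) (h : HA L e dV hdV dW hdW), (n : ℝ) / 2 < s.re →
          Es s h = (∏ p ∈ P, (s - p)) * eisensteinFamilyDelta L e dV hdV dW hdW f s h) ∧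
        (∀ z : ℂ, 0 < z.re → ∃ C A r : ℝ, 0 < r ∧ ∀ s : ℂ, dist s z < r → ∀ h : HA L e dV hdV dW hdW,
          ‖Es s h‖ ≤ C * adelicHeightGL (n + n) L (h : GL (Fin (n + n)) (AdeleRing (𝓞 L) L)) ^ A))
    (hA : ∀ (L : Type) [Field L] [NumberField L] [IsCMField L] {n : ℕ} (e : Fin 2 × Fin 1 ≃ Fin n)
      (dV : Fin 2 → L) (hdV : ∀ i, IsCMField.complexConj L (dV i) = dV i) (hdV0 : ∀ i, dV i ≠ 0)
      (dW : Fin 1 → L) (hdW : ∀ i, IsCMField.complexConj L (dW i) = dW i) (hdW0 : ∀ i, dW i ≠ 0)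
      (lam : Literature.NumberTheory.Automorphic.IdeleClassGroup L →ₜ* Circle) (hlam : IsConjugateSymplectic L lam),
      HasWeight L lam 1 →
      ∀ {M' n' : ℕ} (eW : Fin 1 × Fin 3 ≃ Fin M') (e' : Fin 2 × Fin M' ≃ Fin n')
        (dV' : Fin 3 → L) (hdV' : ∀ k, IsCMField.complexConj L (dV' k) = dV' k) (hdV'0 : ∀ k, dV' k ≠ 0)
        (χb : HeckeCharacter L) (hχbu : χb.IsUnitary) (hχbs : Literature.RepresentationTheory.HarrisKudlaSweet1996.IsSplittingChar L 1 χb)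
        (α : UnitaryGroup.adelicOne (Fp L) L (IsCMField.complexConj L) →* ℂˣ) (hα : Continuous α)
        (hαrat : ∀ u : UnitaryGroup.adelicOne (Fp L) L (IsCMField.complexConj L),
          (u : Literature.NumberTheory.GaloisRepresentations.ideleGroup L) ∈ Literature.NumberTheory.GaloisRepresentations.principalIdeles L → α u = 1)
        (_hχD : χb ^ 3 * DoubledWeilDetTwist.ratioHecke L α hα hαrat = toHeckeCharacter L lam⁻¹)
        (𝒦 : IwasawaDatum L e dV hdV dW hdW) (_h𝒦 : 𝒦.IsStd),
        -- FACE-A («U1-aniso»): for an ANISOTROPIC `V′` (Weil's convergent range, [GQT14 Thm. 18]: `E(s, g_x)` is holomorphic at `s₀ = ½`) the residue map of ★ 0c VANISHES on every `D_V`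
        (¬ ∃ v : Fin 3 → L, v ≠ 0 ∧ ∑ k, dV' k * (v k * IsCMField.complexConj L (v k)) = 0) →
        ∀ (V : Submodule ℂ 𝓢(((Fin (n' + n')) → mixedSpace (Fp L)), ℂ)), FiniteDimensional ℂ V →
          (∀ ainf : UnitaryGroup.arch (Fp L) L (IsCMField.complexConj L) (n + n) (hermD L e dV hdV dW hdW),
            (UnitaryGroup.archToAdelic (Fp L) L (IsCMField.complexConj L) (n + n) (hermD L e dV hdV dW hdW) ainf : HA L e dV hdV dW hdW) ∈ 𝒦.K →
            ∀ a ∈ V, ∃ a'' ∈ V, ∀ f : FinSB (Fp L) (Fin (n' + n')),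
              adelicMpCont.omega (Fp L) (Fin (n' + n')) (gramDA L e' dV hdV (tensorFrame L dW eW dV') (tensorFrame_real L dW hdW eW dV' hdV'))
                  ((doubledWeilRep L e' dV hdV hdV0 (tensorFrame L dW eW dV') (tensorFrame_real L dW hdW eW dV' hdV')
                        (tensorFrame_ne_zero L dW eW dV' hdW0 hdV'0) χb hχbu hχbs)
                    (tensorEmb L e dV hdV dW hdW eW e' dV' hdV'
                      (UnitaryGroup.archToAdelic (Fp L) L (IsCMField.complexConj L) (n + n) (hermD L e dV hdV dW hdW) ainf)))
                  (piSchwartzBruhatEquiv (Fp L) (Fin (n' + n')) (a ⊗ₜ[ℂ] f)) =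
                piSchwartzBruhatEquiv (Fp L) (Fin (n' + n')) (a'' ⊗ₜ[ℂ] f)) →
          ∀ (T₁ : ↥(Submodule.span ℂ {x : piSchwartzBruhat (Fp L) (Fin (n' + n')) |
              ∃ a ∈ V, ∃ f : FinSB (Fp L) (Fin (n' + n')), x = piSchwartzBruhatEquiv (Fp L) (Fin (n' + n')) (a ⊗ₜ[ℂ] f)}) →ₗ[ℂ]
              (HA L e dV hdV dW hdW → ℂ)),
            -- (a) ★ 0c: the value on ANY pole-cleared continuation of `E^Δ(s; g_x)`
            (∀ (x : ↥(Submodule.span ℂ {x : piSchwartzBruhat (Fp L) (Fin (n' + n')) |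
                ∃ a ∈ V, ∃ f : FinSB (Fp L) (Fin (n' + n')), x = piSchwartzBruhatEquiv (Fp L) (Fin (n' + n')) (a ⊗ₜ[ℂ] f)}))
              (Pg : Finset ℂ) (Eg : ℂ → HA L e dV hdV dW hdW → ℂ),
              (∀ h : HA L e dV hdV dW hdW, DifferentiableOn ℂ (fun s => Eg s h) {s : ℂ | 0 < s.re}) →
              (∀ (s : ℂ) (h : HA L e dV hdV dW hdW), (n : ℝ) / 2 < s.re →
                Eg s h = (∏ p ∈ Pg, (s - p)) * eisensteinFamilyDelta L e dV hdV dW hdW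
                  (fun s₁ h₁ => ((DoubledWeilDetTwist.detChar L e dV hdV hdV0 dW hdW hdW0 α h₁ : ℂˣ) : ℂ) *
                    stdExtension 𝒦 ((((3 : ℕ) : ℂ) - (n : ℂ)) / 2)
                      (swSectionTensor L e dV hdV dW hdW eW e' dV' hdV' hdV0 hdW0 hdV'0
                        (doubledWeilRep L e' dV hdV hdV0 (tensorFrame L dW eW dV') (tensorFrame_real L dW hdW eW dV' hdV')
                          (tensorFrame_ne_zero L dW eW dV' hdW0 hdV'0) χb hχbu hχbs)
                        (x : piSchwartzBruhat (Fp L) (Fin (n' + n')))) s₁ h₁) s h) →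
              T₁ x = resNorm Pg Eg) →
            -- (b) ★ 0c: `T₁ x` IS the residue form of a continuation with ALL FIVE clauses of #41
            (∀ x : ↥(Submodule.span ℂ {x : piSchwartzBruhat (Fp L) (Fin (n' + n')) |
                ∃ a ∈ V, ∃ f : FinSB (Fp L) (Fin (n' + n')), x = piSchwartzBruhatEquiv (Fp L) (Fin (n' + n')) (a ⊗ₜ[ℂ] f)}),
              ∃ (P : Finset ℂ) (Es : ℂ → HA L e dV hdV dW hdW → ℂ),
                ((∀ h : HA L e dV hdV dW hdW, DifferentiableOn ℂ (fun s => Es s h) {s : ℂ | 0 < s.re}) ∧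
                (∀ s : ℂ, 0 < s.re → Continuous (Es s)) ∧
                (∀ s : ℂ, 0 < s.re → ∀ (γ : ratH L e dV hdV dW hdW) (h : HA L e dV hdV dW hdW),
                  Es s ((γ : HA L e dV hdV dW hdW) * h) = Es s h) ∧
                (∀ (s : ℂ) (h : HA L e dV hdV dW hdW), (n : ℝ) / 2 < s.re →
                  Es s h = (∏ p ∈ P, (s - p)) * eisensteinFamilyDelta L e dV hdV dW hdW
                    (fun s₁ h₁ => ((DoubledWeilDetTwist.detChar L e dV hdV hdV0 dW hdW hdW0 α h₁ : ℂˣ) : ℂ) *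
                      stdExtension 𝒦 ((((3 : ℕ) : ℂ) - (n : ℂ)) / 2)
                        (swSectionTensor L e dV hdV dW hdW eW e' dV' hdV' hdV0 hdW0 hdV'0
                          (doubledWeilRep L e' dV hdV hdV0 (tensorFrame L dW eW dV') (tensorFrame_real L dW hdW eW dV' hdV')
                            (tensorFrame_ne_zero L dW eW dV' hdW0 hdV'0) χb hχbu hχbs)
                          (x : piSchwartzBruhat (Fp L) (Fin (n' + n')))) s₁ h₁) s h) ∧
                (∀ z : ℂ, 0 < z.re → ∃ C A r : ℝ, 0 < r ∧ ∀ s : ℂ, dist s z < r → ∀ h : HA L e dV hdV dW hdW,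
                  ‖Es s h‖ ≤ C * adelicHeightGL (n + n) L (h : GL (Fin (n + n)) (AdeleRing (𝓞 L) L)) ^ A)) ∧
                T₁ x = resNorm P Es) →
            -- (c) ★ 0c: continuous, left-`H(L⁺)`-invariant, of moderate growth
            (∀ x, Continuous (T₁ x)) →
            (∀ x (γ : ratH L e dV hdV dW hdW) (h : HA L e dV hdV dW hdW), T₁ x ((γ : HA L e dV hdV dW hdW) * h) = T₁ x h) →
            (∀ x, ∃ C A : ℝ, ∀ h : HA L e dV hdV dW hdW,
              ‖T₁ x h‖ ≤ C * adelicHeightGL (n + n) L (h : GL (Fin (n + n)) (AdeleRing (𝓞 L) L)) ^ A) →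
            ∀ x, T₁ x = 0)
    (hD' : ∀ (L : Type) [Field L] [NumberField L] [IsCMField L] {n : ℕ} (e : Fin 2 × Fin 1 ≃ Fin n)
      (dV : Fin 2 → L) (hdV : ∀ i, IsCMField.complexConj L (dV i) = dV i) (hdV0 : ∀ i, dV i ≠ 0)
      (dW : Fin 1 → L) (hdW : ∀ i, IsCMField.complexConj L (dW i) = dW i) (hdW0 : ∀ i, dW i ≠ 0)
      (lam : Literature.NumberTheory.Automorphic.IdeleClassGroup L →ₜ* Circle) (hlam : IsConjugateSymplectic L lam),
      HasWeight L lam 1 →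
      ∀ {M' n' : ℕ} (eW : Fin 1 × Fin 3 ≃ Fin M') (e' : Fin 2 × Fin M' ≃ Fin n')
        (dV' : Fin 3 → L) (hdV' : ∀ k, IsCMField.complexConj L (dV' k) = dV' k) (hdV'0 : ∀ k, dV' k ≠ 0)
        (χb : HeckeCharacter L) (hχbu : χb.IsUnitary) (hχbs : Literature.RepresentationTheory.HarrisKudlaSweet1996.IsSplittingChar L 1 χb)
        (α : UnitaryGroup.adelicOne (Fp L) L (IsCMField.complexConj L) →* ℂˣ) (hα : Continuous α)
        (hαrat : ∀ u : UnitaryGroup.adelicOne (Fp L) L (IsCMField.complexConj L),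
          (u : Literature.NumberTheory.GaloisRepresentations.ideleGroup L) ∈ Literature.NumberTheory.GaloisRepresentations.principalIdeles L → α u = 1)
        (_hχD : χb ^ 3 * DoubledWeilDetTwist.ratioHecke L α hα hαrat = toHeckeCharacter L lam⁻¹)
        (𝒦 : IwasawaDatum L e dV hdV dW hdW) (_h𝒦 : 𝒦.IsStd)
      {n'' : ℕ} (e₁ : Fin (n + n) × Fin 1 ≃ Fin n''),
      -- FACE-D: for an ISOTROPIC `V′`, `a′` is THE LINE OF RECORD — the Witt-complement line of ★ `exists_lineFrame` (frame `T`, discriminant clause) BY VALUE …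
      ∀ (a' : (↥(maximalRealSubfield L))ˣ) (T : GL (Fin 3) (AdeleRing (𝓞 L) L)),
        formCongr (conjAdele (Fp L) L (IsCMField.complexConj L)) T (adelicForm L 3 (Matrix.diagonal dV')) =
          adelicForm L (1 + 2) (finSum 1 2 (JW (Fp L) L a') !![0, 1; 1, 0]) →
        -((a' : Fp L) : L) ∈ (Set.range fun A : Matrix (Fin 3) (Fin 3) L =>
          (A.map (IsCMField.complexConj L : L →+* L)).det * (∏ k, dV' k) * A.det) →
        -- … then SOME theta datum `(hρ, μW, fw)` on `⟨a′⟩` — the PAYER's choice; the WEIGHT OF RECORD `fw` is pinned by row `h₁` (module docstring) — with …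
        ∃ (hρ : HasThetaMajorants fun
          (p : ↥(UnitaryGroup.adelic (↥(maximalRealSubfield L)) L (IsCMField.complexConj L) (n + n) (Matrix.diagonal (dD L e dV hdV dW hdW))) ×
            ↥(UnitaryGroup.adelic (↥(maximalRealSubfield L)) L (IsCMField.complexConj L) 1 (JW (↥(maximalRealSubfield L)) L a')))
          (Ψ : piSchwartzBruhat (↥(maximalRealSubfield L)) (Fin n'')) =>
            pairRep (↥(maximalRealSubfield L)) L (IsCMField.complexConj L) (n + n) 1 e₁ (Matrix.diagonal (dD L e dV hdV dW hdW)) (JW (↥(maximalRealSubfield L)) L a')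
              (chiSplittingLine L e₁ (dD L e dV hdV dW hdW) (dD_conj L e dV hdV dW hdW) (dD_ne_zero L e dV hdV dW hdW hdV0 hdW0)
                (toHeckeCharacter L lam⁻¹) (isUnitary_toHeckeCharacter L lam⁻¹)
                ((isOscillatorChar_toHeckeCharacter_iff lam⁻¹).mpr (K2LiuConjugateSymplecticInv.IsConjugateSymplectic.inv hlam)) (TW (↥(maximalRealSubfield L)) a')
                (isUnit_det_TW (↥(maximalRealSubfield L)) a') (JW (↥(maximalRealSubfield L)) L a') (JW_eq (↥(maximalRealSubfield L)) L a'))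
              p Ψ)
        (μW : @Measure (↥(UnitaryGroup.adelic (↥(maximalRealSubfield L)) L (IsCMField.complexConj L) 1 (JW (↥(maximalRealSubfield L)) L a')) ⧸
          (UnitaryGroup.toAdelic (↥(maximalRealSubfield L)) L (IsCMField.complexConj L) 1 (JW (↥(maximalRealSubfield L)) L a')).range) (borel _))
        (fw : C(↥(UnitaryGroup.adelic (↥(maximalRealSubfield L)) L (IsCMField.complexConj L) 1 (JW (↥(maximalRealSubfield L)) L a')) ⧸
          (UnitaryGroup.toAdelic (↥(maximalRealSubfield L)) L (IsCMField.complexConj L) 1 (JW (↥(maximalRealSubfield L)) L a')).range, ℂ)),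
        @IsFiniteMeasure _ (borel _) μW ∧
        @SMulInvariantMeasure
          ↥(UnitaryGroup.adelic (↥(maximalRealSubfield L)) L (IsCMField.complexConj L) 1 (JW (↥(maximalRealSubfield L)) L a'))
          (↥(UnitaryGroup.adelic (↥(maximalRealSubfield L)) L (IsCMField.complexConj L) 1 (JW (↥(maximalRealSubfield L)) L a')) ⧸
            (UnitaryGroup.toAdelic (↥(maximalRealSubfield L)) L (IsCMField.complexConj L) 1 (JW (↥(maximalRealSubfield L)) L a')).range)
          _ (borel _) μW ∧
        -- … on every rigidity domain `D_V` and for every admissible `T₁`: ★ U2 `rankOneRigidity`'s inputs at `T₂ := B ∘ 𝓣` (with `hne`)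
        ∀ (V : Submodule ℂ 𝓢(((Fin (n' + n')) → mixedSpace (Fp L)), ℂ)), FiniteDimensional ℂ V →
          (∀ ainf : UnitaryGroup.arch (Fp L) L (IsCMField.complexConj L) (n + n) (hermD L e dV hdV dW hdW),
            (UnitaryGroup.archToAdelic (Fp L) L (IsCMField.complexConj L) (n + n) (hermD L e dV hdV dW hdW) ainf : HA L e dV hdV dW hdW) ∈ 𝒦.K →
            ∀ a ∈ V, ∃ a'' ∈ V, ∀ f : FinSB (Fp L) (Fin (n' + n')),
              adelicMpCont.omega (Fp L) (Fin (n' + n')) (gramDA L e' dV hdV (tensorFrame L dW eW dV') (tensorFrame_real L dW hdW eW dV' hdV'))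
                  ((doubledWeilRep L e' dV hdV hdV0 (tensorFrame L dW eW dV') (tensorFrame_real L dW hdW eW dV' hdV')
                        (tensorFrame_ne_zero L dW eW dV' hdW0 hdV'0) χb hχbu hχbs)
                    (tensorEmb L e dV hdV dW hdW eW e' dV' hdV'
                      (UnitaryGroup.archToAdelic (Fp L) L (IsCMField.complexConj L) (n + n) (hermD L e dV hdV dW hdW) ainf)))
                  (piSchwartzBruhatEquiv (Fp L) (Fin (n' + n')) (a ⊗ₜ[ℂ] f)) =
                piSchwartzBruhatEquiv (Fp L) (Fin (n' + n')) (a'' ⊗ₜ[ℂ] f)) →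
          ∀ (T₁ : ↥(Submodule.span ℂ {x : piSchwartzBruhat (Fp L) (Fin (n' + n')) |
              ∃ a ∈ V, ∃ f : FinSB (Fp L) (Fin (n' + n')), x = piSchwartzBruhatEquiv (Fp L) (Fin (n' + n')) (a ⊗ₜ[ℂ] f)}) →ₗ[ℂ]
              (HA L e dV hdV dW hdW → ℂ)),
            -- (a) ★ 0c: the value on ANY pole-cleared continuation of `E^Δ(s; g_x)`
            (∀ (x : ↥(Submodule.span ℂ {x : piSchwartzBruhat (Fp L) (Fin (n' + n')) |
                ∃ a ∈ V, ∃ f : FinSB (Fp L) (Fin (n' + n')), x = piSchwartzBruhatEquiv (Fp L) (Fin (n' + n')) (a ⊗ₜ[ℂ] f)}))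
              (Pg : Finset ℂ) (Eg : ℂ → HA L e dV hdV dW hdW → ℂ),
              (∀ h : HA L e dV hdV dW hdW, DifferentiableOn ℂ (fun s => Eg s h) {s : ℂ | 0 < s.re}) →
              (∀ (s : ℂ) (h : HA L e dV hdV dW hdW), (n : ℝ) / 2 < s.re →
                Eg s h = (∏ p ∈ Pg, (s - p)) * eisensteinFamilyDelta L e dV hdV dW hdW
                  (fun s₁ h₁ => ((DoubledWeilDetTwist.detChar L e dV hdV hdV0 dW hdW hdW0 α h₁ : ℂˣ) : ℂ) *
                    stdExtension 𝒦 ((((3 : ℕ) : ℂ) - (n : ℂ)) / 2)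
                      (swSectionTensor L e dV hdV dW hdW eW e' dV' hdV' hdV0 hdW0 hdV'0
                        (doubledWeilRep L e' dV hdV hdV0 (tensorFrame L dW eW dV') (tensorFrame_real L dW hdW eW dV' hdV')
                          (tensorFrame_ne_zero L dW eW dV' hdW0 hdV'0) χb hχbu hχbs)
                        (x : piSchwartzBruhat (Fp L) (Fin (n' + n')))) s₁ h₁) s h) →
              T₁ x = resNorm Pg Eg) →
            -- (b) ★ 0c: `T₁ x` IS the residue form of a continuation with ALL FIVE clauses of #41
            (∀ x : ↥(Submodule.span ℂ {x : piSchwartzBruhat (Fp L) (Fin (n' + n')) |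
                ∃ a ∈ V, ∃ f : FinSB (Fp L) (Fin (n' + n')), x = piSchwartzBruhatEquiv (Fp L) (Fin (n' + n')) (a ⊗ₜ[ℂ] f)}),
              ∃ (P : Finset ℂ) (Es : ℂ → HA L e dV hdV dW hdW → ℂ),
                ((∀ h : HA L e dV hdV dW hdW, DifferentiableOn ℂ (fun s => Es s h) {s : ℂ | 0 < s.re}) ∧
                (∀ s : ℂ, 0 < s.re → Continuous (Es s)) ∧
                (∀ s : ℂ, 0 < s.re → ∀ (γ : ratH L e dV hdV dW hdW) (h : HA L e dV hdV dW hdW),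
                  Es s ((γ : HA L e dV hdV dW hdW) * h) = Es s h) ∧
                (∀ (s : ℂ) (h : HA L e dV hdV dW hdW), (n : ℝ) / 2 < s.re →
                  Es s h = (∏ p ∈ P, (s - p)) * eisensteinFamilyDelta L e dV hdV dW hdW
                    (fun s₁ h₁ => ((DoubledWeilDetTwist.detChar L e dV hdV hdV0 dW hdW hdW0 α h₁ : ℂˣ) : ℂ) *
                      stdExtension 𝒦 ((((3 : ℕ) : ℂ) - (n : ℂ)) / 2)
                        (swSectionTensor L e dV hdV dW hdW eW e' dV' hdV' hdV0 hdW0 hdV'0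
                          (doubledWeilRep L e' dV hdV hdV0 (tensorFrame L dW eW dV') (tensorFrame_real L dW hdW eW dV' hdV')
                            (tensorFrame_ne_zero L dW eW dV' hdW0 hdV'0) χb hχbu hχbs)
                          (x : piSchwartzBruhat (Fp L) (Fin (n' + n')))) s₁ h₁) s h) ∧
                (∀ z : ℂ, 0 < z.re → ∃ C A r : ℝ, 0 < r ∧ ∀ s : ℂ, dist s z < r → ∀ h : HA L e dV hdV dW hdW,
                  ‖Es s h‖ ≤ C * adelicHeightGL (n + n) L (h : GL (Fin (n + n)) (AdeleRing (𝓞 L) L)) ^ A)) ∧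
                T₁ x = resNorm P Es) →
            -- (c) ★ 0c: continuous, left-`H(L⁺)`-invariant, of moderate growth
            (∀ x, Continuous (T₁ x)) →
            (∀ x (γ : ratH L e dV hdV dW hdW) (h : HA L e dV hdV dW hdW), T₁ x ((γ : HA L e dV hdV dW hdW) * h) = T₁ x h) →
            (∀ x, ∃ C A : ℝ, ∀ h : HA L e dV hdV dW hdW,
              ‖T₁ x h‖ ≤ C * adelicHeightGL (n + n) L (h : GL (Fin (n + n)) (AdeleRing (𝓞 L) L)) ^ A) →
            ∃ (𝓣 : ↥(Submodule.span ℂ {x : piSchwartzBruhat (Fp L) (Fin (n' + n')) |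
                ∃ a ∈ V, ∃ f : FinSB (Fp L) (Fin (n' + n')), x = piSchwartzBruhatEquiv (Fp L) (Fin (n' + n')) (a ⊗ₜ[ℂ] f)}) →ₗ[ℂ]
                  piSchwartzBruhat (↥(maximalRealSubfield L)) (Fin n''))
              (T₂ : ↥(Submodule.span ℂ {x : piSchwartzBruhat (Fp L) (Fin (n' + n')) |
                  ∃ a ∈ V, ∃ f : FinSB (Fp L) (Fin (n' + n')), x = piSchwartzBruhatEquiv (Fp L) (Fin (n' + n')) (a ⊗ₜ[ℂ] f)}) →ₗ[ℂ] (HA L e dV hdV dW hdW → ℂ)),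
              -- the theta side IS the doubled line theta lift after the carrier `𝓣` (★ D8 at `λ⁻¹`, bytes of #42F′'s conclusion)
              (∀ x (h : HA L e dV hdV dW hdW), T₂ x h = @doubledLineThetaLift L _ _ _ 2 1 n e dV hdV dW hdW n'' e₁ hdV0 hdW0 lam⁻¹
                  (K2LiuConjugateSymplecticInv.IsConjugateSymplectic.inv hlam) a' hρ (borel _) μW (𝓣 x) fw h) ∧
              -- the value class `P ∋ T₁ x, T₂ x` and the rigidity data: ★ U2 `rankOneRigidity`'s binders at `N := ↥P`, `M := H(𝔸) → ℂ`, BY VALUE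
              ∃ (P : Submodule ℂ (HA L e dV hdV dW hdW → ℂ)) (hP₁ : ∀ x, T₁ x ∈ P) (hP₂ : ∀ x, T₂ x ∈ P)
                (coeff : Matrix (Fin 2) (Fin 2) L → ↥P →ₗ[ℂ] (HA L e dV hdV dW hdW → ℂ))
                (R : Matrix (Fin 2) (Fin 2) L → (HA L e dV hdV dW hdW → ℂ) →ₗ[ℂ] (HA L e dV hdV dW hdW → ℂ))
                (S : Matrix (Fin 2) (Fin 2) L → ↥(Submodule.span ℂ {x : piSchwartzBruhat (Fp L) (Fin (n' + n')) |
                    ∃ a ∈ V, ∃ f : FinSB (Fp L) (Fin (n' + n')), x = piSchwartzBruhatEquiv (Fp L) (Fin (n' + n')) (a ⊗ₜ[ℂ] f)}) →ₗ[ℂ]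
                  ↥(Submodule.span ℂ {x : piSchwartzBruhat (Fp L) (Fin (n' + n')) |
                      ∃ a ∈ V, ∃ f : FinSB (Fp L) (Fin (n' + n')), x = piSchwartzBruhatEquiv (Fp L) (Fin (n' + n')) (a ⊗ₜ[ℂ] f)})),
                -- `hdet` (Hol.3c): a member of `P` all of whose non-zero hermitian coefficients vanish is `0`
                (∀ y : ↥P, (∀ β : Matrix (Fin 2) (Fin 2) L, (β.map (IsCMField.complexConj L))ᵀ = β → β ≠ 0 → coeff β y = 0) → y = 0) ∧
                -- `hT₁` `hT₂` (U3): automorphy of the coefficients under the rational Levi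
                (∀ γ : Matrix (Fin 2) (Fin 2) L, IsUnit γ.det → ∀ β : Matrix (Fin 2) (Fin 2) L,
                  coeff ((γ.map (IsCMField.complexConj L))ᵀ * β * γ) ∘ₗ LinearMap.codRestrict P T₁ hP₁ =
                    R γ ∘ₗ (coeff β ∘ₗ LinearMap.codRestrict P T₁ hP₁) ∘ₗ S γ) ∧
                (∀ γ : Matrix (Fin 2) (Fin 2) L, IsUnit γ.det → ∀ β : Matrix (Fin 2) (Fin 2) L,
                  coeff ((γ.map (IsCMField.complexConj L))ᵀ * β * γ) ∘ₗ LinearMap.codRestrict P T₂ hP₂ =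
                    R γ ∘ₗ (coeff β ∘ₗ LinearMap.codRestrict P T₂ hP₂) ∘ₗ S γ) ∧
                -- `h2₁` `h2₂` (U2a through F-T1-coinv ∕ U4): no coefficients at non-degenerate hermitian `β`
                (∀ β : Matrix (Fin 2) (Fin 2) L, (β.map (IsCMField.complexConj L))ᵀ = β → β.det ≠ 0 →
                  coeff β ∘ₗ LinearMap.codRestrict P T₁ hP₁ = 0) ∧
                (∀ β : Matrix (Fin 2) (Fin 2) L, (β.map (IsCMField.complexConj L))ᵀ = β → β.det ≠ 0 →
                  coeff β ∘ₗ LinearMap.codRestrict P T₂ hP₂ = 0) ∧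
                -- `hfin₁` `hfin₂` (U2c-fin + archimedean signs, ONE SIDE EACH): a surviving rank-one index lies in the class of the line `a′`
                (∀ (b : (↥(maximalRealSubfield L))ˣ) (u : Fin 2 → L), (∃ k, u k = 1) →
                  coeff (algebraMap ↥(maximalRealSubfield L) L b • Matrix.vecMulVec (⇑(IsCMField.complexConj L) ∘ u) u) ∘ₗ
                      LinearMap.codRestrict P T₁ hP₁ ≠ 0 →
                  (∀ v : HeightOneSpectrum (𝓞 ↥(maximalRealSubfield L)),
                      locF ↥(maximalRealSubfield L) (imagUnitSq L) b v = locF ↥(maximalRealSubfield L) (imagUnitSq L) a' v) ∧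
                    ∀ ρ : ↥(maximalRealSubfield L) →+* ℝ, 0 < ρ ((b : ↥(maximalRealSubfield L)) * ((a' : ↥(maximalRealSubfield L)))⁻¹)) ∧
                (∀ (b : (↥(maximalRealSubfield L))ˣ) (u : Fin 2 → L), (∃ k, u k = 1) →
                  coeff (algebraMap ↥(maximalRealSubfield L) L b • Matrix.vecMulVec (⇑(IsCMField.complexConj L) ∘ u) u) ∘ₗ
                      LinearMap.codRestrict P T₂ hP₂ ≠ 0 →
                  (∀ v : HeightOneSpectrum (𝓞 ↥(maximalRealSubfield L)),
                      locF ↥(maximalRealSubfield L) (imagUnitSq L) b v = locF ↥(maximalRealSubfield L) (imagUnitSq L) a' v) ∧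
                    ∀ ρ : ↥(maximalRealSubfield L) →+* ℝ, 0 < ρ ((b : ↥(maximalRealSubfield L)) * ((a' : ↥(maximalRealSubfield L)))⁻¹)) ∧
                -- `h₁` (U2b ∕ U2e through F-T1-coinv ∕ (F4)): at `β₀ = diag(a′, 0)` the residue side's coefficient is a MULTIPLE of the theta side's
                -- (`lam₀ := coeff β₀ ∘ T₂`, `c₂ := 1`; NO `hne`: ★ `rankOneRigidityDegenerate` closes the degenerate domains with `c := 0`) — this row PINS the weight `fw`
                ∃ c₁ : ℂ, coeff (Matrix.diagonal ![algebraMap ↥(maximalRealSubfield L) L a', 0]) ∘ₗ LinearMap.codRestrict P T₁ hP₁ =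
                  c₁ • (coeff (Matrix.diagonal ![algebraMap ↥(maximalRealSubfield L) L a', 0]) ∘ₗ LinearMap.codRestrict P T₂ hP₂)) :
    -- ‹#42F′ :711–771 verbatim›
    ∀ (L : Type) [Field L] [NumberField L] [IsCMField L] {n : ℕ} (e : Fin 2 × Fin 1 ≃ Fin n)
      (dV : Fin 2 → L) (hdV : ∀ i, IsCMField.complexConj L (dV i) = dV i) (hdV0 : ∀ i, dV i ≠ 0)
      (dW : Fin 1 → L) (hdW : ∀ i, IsCMField.complexConj L (dW i) = dW i) (hdW0 : ∀ i, dW i ≠ 0)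
      (lam : Literature.NumberTheory.Automorphic.IdeleClassGroup L →ₜ* Circle) (hlam : IsConjugateSymplectic L lam),
      HasWeight L lam 1 →
      ∀ {M' n' : ℕ} (eW : Fin 1 × Fin 3 ≃ Fin M') (e' : Fin 2 × Fin M' ≃ Fin n')
        (dV' : Fin 3 → L) (hdV' : ∀ k, IsCMField.complexConj L (dV' k) = dV' k) (hdV'0 : ∀ k, dV' k ≠ 0)
        (χb : HeckeCharacter L) (hχbu : χb.IsUnitary) (hχbs : Literature.RepresentationTheory.HarrisKudlaSweet1996.IsSplittingChar L 1 χb)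
        (α : UnitaryGroup.adelicOne (Fp L) L (IsCMField.complexConj L) →* ℂˣ) (hα : Continuous α)
        (hαrat : ∀ u : UnitaryGroup.adelicOne (Fp L) L (IsCMField.complexConj L),
          (u : Literature.NumberTheory.GaloisRepresentations.ideleGroup L) ∈ Literature.NumberTheory.GaloisRepresentations.principalIdeles L → α u = 1)
        (_hχD : χb ^ 3 * DoubledWeilDetTwist.ratioHecke L α hα hαrat = toHeckeCharacter L lam⁻¹)
        (𝒦 : IwasawaDatum L e dV hdV dW hdW) (_h𝒦 : 𝒦.IsStd)
        (Φ : piSchwartzBruhat (Fp L) (Fin (n' + n')))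
        (_hΦ : FiniteDimensional ℂ (Submodule.span ℂ (Set.range fun k : 𝒦.K =>
          adelicMpCont.omega (Fp L) (Fin (n' + n')) (gramDA L e' dV hdV (tensorFrame L dW eW dV') (tensorFrame_real L dW hdW eW dV' hdV'))
            ((doubledWeilRep L e' dV hdV hdV0 (tensorFrame L dW eW dV') (tensorFrame_real L dW hdW eW dV' hdV')
                    (tensorFrame_ne_zero L dW eW dV' hdW0 hdV'0) χb hχbu hχbs)
              (tensorEmb L e dV hdV dW hdW eW e' dV' hdV' (k : HA L e dV hdV dW hdW))) Φ)))
        (Pg : Finset ℂ) (Eg : ℂ → HA L e dV hdV dW hdW → ℂ),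
        (∀ h : HA L e dV hdV dW hdW, DifferentiableOn ℂ (fun s => Eg s h) {s : ℂ | 0 < s.re}) →
        (∀ (s : ℂ) (h : HA L e dV hdV dW hdW), (n : ℝ) / 2 < s.re →
          Eg s h = (∏ p ∈ Pg, (s - p)) * eisensteinFamilyDelta L e dV hdV dW hdW
            (fun s₁ h₁ => ((DoubledWeilDetTwist.detChar L e dV hdV hdV0 dW hdW hdW0 α h₁ : ℂˣ) : ℂ) *
              stdExtension 𝒦 ((((3 : ℕ) : ℂ) - (n : ℂ)) / 2)
                (swSectionTensor L e dV hdV dW hdW eW e' dV' hdV' hdV0 hdW0 hdV'0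
                  (doubledWeilRep L e' dV hdV hdV0 (tensorFrame L dW eW dV') (tensorFrame_real L dW hdW eW dV' hdV')
                    (tensorFrame_ne_zero L dW eW dV' hdW0 hdV'0) χb hχbu hχbs) Φ) s₁ h₁) s h) →
      ∀ {n'' : ℕ} (e₁ : Fin (n + n) × Fin 1 ≃ Fin n''),
      ∃ (a' : (↥(maximalRealSubfield L))ˣ) (κ : ℂ) (_hκ : κ ≠ 0) (Φ' : piSchwartzBruhat (↥(maximalRealSubfield L)) (Fin n''))
        (hρ : HasThetaMajorants fun
          (p : ↥(UnitaryGroup.adelic (↥(maximalRealSubfield L)) L (IsCMField.complexConj L) (n + n) (Matrix.diagonal (dD L e dV hdV dW hdW))) ×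
            ↥(UnitaryGroup.adelic (↥(maximalRealSubfield L)) L (IsCMField.complexConj L) 1 (JW (↥(maximalRealSubfield L)) L a')))
          (Ψ : piSchwartzBruhat (↥(maximalRealSubfield L)) (Fin n'')) =>
            pairRep (↥(maximalRealSubfield L)) L (IsCMField.complexConj L) (n + n) 1 e₁ (Matrix.diagonal (dD L e dV hdV dW hdW)) (JW (↥(maximalRealSubfield L)) L a')
              (chiSplittingLine L e₁ (dD L e dV hdV dW hdW) (dD_conj L e dV hdV dW hdW) (dD_ne_zero L e dV hdV dW hdW hdV0 hdW0)
                (toHeckeCharacter L lam⁻¹) (isUnitary_toHeckeCharacter L lam⁻¹)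
                ((isOscillatorChar_toHeckeCharacter_iff lam⁻¹).mpr (K2LiuConjugateSymplecticInv.IsConjugateSymplectic.inv hlam)) (TW (↥(maximalRealSubfield L)) a')
                (isUnit_det_TW (↥(maximalRealSubfield L)) a') (JW (↥(maximalRealSubfield L)) L a') (JW_eq (↥(maximalRealSubfield L)) L a'))
              p Ψ)
        (μW : @Measure (↥(UnitaryGroup.adelic (↥(maximalRealSubfield L)) L (IsCMField.complexConj L) 1 (JW (↥(maximalRealSubfield L)) L a')) ⧸
          (UnitaryGroup.toAdelic (↥(maximalRealSubfield L)) L (IsCMField.complexConj L) 1 (JW (↥(maximalRealSubfield L)) L a')).range) (borel _))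
        (fw : C(↥(UnitaryGroup.adelic (↥(maximalRealSubfield L)) L (IsCMField.complexConj L) 1 (JW (↥(maximalRealSubfield L)) L a')) ⧸
          (UnitaryGroup.toAdelic (↥(maximalRealSubfield L)) L (IsCMField.complexConj L) 1 (JW (↥(maximalRealSubfield L)) L a')).range, ℂ)),
        @IsFiniteMeasure _ (borel _) μW ∧
        @SMulInvariantMeasure
          ↥(UnitaryGroup.adelic (↥(maximalRealSubfield L)) L (IsCMField.complexConj L) 1 (JW (↥(maximalRealSubfield L)) L a'))
          (↥(UnitaryGroup.adelic (↥(maximalRealSubfield L)) L (IsCMField.complexConj L) 1 (JW (↥(maximalRealSubfield L)) L a')) ⧸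
            (UnitaryGroup.toAdelic (↥(maximalRealSubfield L)) L (IsCMField.complexConj L) 1 (JW (↥(maximalRealSubfield L)) L a')).range)
          _ (borel _) μW ∧
        ∀ h : HA L e dV hdV dW hdW,
          Tendsto (fun s : ℂ => (s - 1 / 2) * (Eg s h / ∏ p ∈ Pg, (s - p))) (𝓝[≠] (1 / 2))
            (𝓝 (κ * @doubledLineThetaLift L _ _ _ 2 1 n e dV hdV dW hdW n'' e₁ hdV0 hdW0 lam⁻¹ (K2LiuConjugateSymplecticInv.IsConjugateSymplectic.inv hlam) a' hρ
              (borel _) μW Φ' fw h)) := by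
  refine firstTermIdentityOnGenerators_of_rigidityFace h41 ?_
  -- ‹FACE-R› from FACE-A ∕ FACE-D′ by cases on the isotropy of `V′`
  intro L _ _ _ n e dV hdV hdV0 dW hdW hdW0 lam hlam hwt M' n' eW e' dV' hdV' hdV'0 χb hχbu hχbs α hα hαrat hχD 𝒦 h𝒦 n'' e₁
  by_cases hiso : ∃ v : Fin 3 → L, v ≠ 0 ∧ ∑ k, dV' k * (v k * IsCMField.complexConj L (v k)) = 0
  · -- ISOTROPIC `V′`: the line of record from the adelic Witt frame (★ p861452 over ★ (W)), the payer's datum, ★ U2 `rankOneRigidity`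
    obtain ⟨a', T, hT, hdisc⟩ := exists_lineFrame L dV' hdV' hdV'0 hiso
    obtain ⟨hρ, μW, fw, hfin, hinv, hrows⟩ :=
      hD' L e dV hdV hdV0 dW hdW hdW0 lam hlam hwt eW e' dV' hdV' hdV'0 χb hχbu hχbs α hα hαrat hχD 𝒦 h𝒦 e₁ a' T hT hdisc
    refine ⟨a', hρ, μW, fw, hfin, hinv, ?_⟩
    intro V hVfd harch T₁ hTa hTb hTc hTγ hTg x
    obtain ⟨𝓣, T₂, hT₂B, P, hP₁, hP₂, coeff, R, S, hdet, hT₁', hT₂', h2₁, h2₂, hfin₁, hfin₂, c₁, h₁⟩ :=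
      hrows V hVfd harch T₁ hTa hTb hTc hTγ hTg
    -- ★ U2 without `hne` (K2Liu-p10 (g6)): proportional in the value class `↥P`; `c := 0` on a degenerate domain
    obtain ⟨c, hc⟩ := rankOneRigidity_of_eq_smul_split
      (D := ↥(Submodule.span ℂ {x : piSchwartzBruhat (Fp L) (Fin (n' + n')) |
        ∃ a ∈ V, ∃ f : FinSB (Fp L) (Fin (n' + n')), x = piSchwartzBruhatEquiv (Fp L) (Fin (n' + n')) (a ⊗ₜ[ℂ] f)}))
      (M := HA L e dV hdV dW hdW → ℂ) (N := ↥P) L (LinearMap.codRestrict P T₁ hP₁) (LinearMap.codRestrict P T₂ hP₂) coeff a' R S ⊤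
      (fun _ => Submodule.mem_top) (fun _ => Submodule.mem_top) (fun y _ hy => hdet y hy) hT₁' hT₂' h2₁ h2₂ hfin₁ hfin₂ h₁
    have hcx : T₁ x = c • T₂ x := by
      have h := congrArg Subtype.val (hc x)
      simpa only [LinearMap.codRestrict_apply, Submodule.coe_smul] using h
    letI : MeasurableSpace (↥(UnitaryGroup.adelic (Fp L) L (IsCMField.complexConj L) 1 (JW (Fp L) L a')) ⧸
        (UnitaryGroup.toAdelic (Fp L) L (IsCMField.complexConj L) 1 (JW (Fp L) L a')).range) := borel _
    refine ⟨c • 𝓣 x, fun h => ?_⟩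
    rw [doubledLineThetaLift_smul, ← hT₂B x h, hcx, Pi.smul_apply, smul_eq_mul]
  · -- ANISOTROPIC `V′`: the residue map vanishes (FACE-A); any line carries `Φ′ := 0` — take `a′ := 1` and the theta datum of record on `⟨1⟩`
    letI : MeasurableSpace (↥(UnitaryGroup.adelic (Fp L) L (IsCMField.complexConj L) 1 (JW (Fp L) L 1)) ⧸
        (UnitaryGroup.toAdelic (Fp L) L (IsCMField.complexConj L) 1 (JW (Fp L) L 1)).range) := borel _
    obtain ⟨hρ, μW, χ, fw, Φ₀, hfin, hinv, -, -, -, -, -, -⟩ :=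
      exists_lineThetaSide_witness L e dV hdV hdV0 dW hdW hdW0 lam⁻¹ (K2LiuConjugateSymplecticInv.IsConjugateSymplectic.inv hlam) 1 e₁
    refine ⟨1, hρ, μW, fw, hfin, hinv, ?_⟩
    intro V hVfd harch T₁ hTa hTb hTc hTγ hTg x
    have hx : T₁ x = 0 :=
      hA L e dV hdV hdV0 dW hdW hdW0 lam hlam hwt eW e' dV' hdV' hdV'0 χb hχbu hχbs α hα hαrat hχD 𝒦 h𝒦 hiso V hVfd harch T₁ hTa hTb hTc hTγ hTg x
    refine ⟨0, fun h => ?_⟩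
    rw [hx, Pi.zero_apply, ← zero_smul ℂ (0 : piSchwartzBruhat (Fp L) (Fin n'')), doubledLineThetaLift_smul, zero_mul]

end Summit.HodgeConjecture.HodgeConjecture.Cruxes.HLiu418.K2LiuFirstTermIdentityAssemblyDatumPrime

end
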